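import Summits.Ventures.PercRepro.RankLevelSetSkewConv
import Summits.Ventures.PercRepro.RankLevelSetMinorPairUniform
import Summits.Ventures.PercRepro.RankLevelSetBiIndepContainSkewEmpty

/-! # RankLevelSetMinorPairSkewSum — THE CUMULATIVE SKEW OF MIXED PROFILES IS ADDITIVE UNDER DIRECT SUMS WITH ANY
SPLIT SIGNATURE; THE SPLIT ⊕-CLOSURE OF (CX*) WITH A HALF-RULE SUMMAND; THE HALF-STEP BOUND (night-1 g30; dossier §42)

`MinorPairSkew M Y₁ Y₂ R` (g29) is the cumulative skew `SkewConv.Skew (minorPairCount M Y₁ Y₂) R` of the mixed profile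
`p_i(Y₁, Y₂)` of the pair of complementary minors `(M/Y₁∖Y₂, M/Y₂∖Y₁)`, and the profile of a direct sum with a split
signature is the convolution of the factors' profiles (`minorPairCount_disjointSum`, g29). With `SkewConv.skew_conv`
(`Skew a R₁ → Skew b R₂ → Skew (a ⋆ b) (R₁ + R₂)`):
* **`minorPairSkew_disjointSum`**: `MinorPairSkew M A₁ B₁ R₁ → MinorPairSkew N A₂ B₂ R₂ →`
  `MinorPairSkew (M ⊕ N) (A₁ ∪ A₂) (B₁ ∪ B₂) (R₁ + R₂)` — for EVERY split signature, crossing pairs included (the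
  `(m, ρ)`-parametrised skews of g29 are false on crossing pairs; the ADDITIVE parameter is what survives).
* Contain-sets (`B = ∅`; the cumulative (CX*) of `(M, X)` is `MinorPairSkew M X ∅ (#E − 2#X − 1)`, the cumulative HALF
  RULE «skewed right about `#E/2`» is `MinorPairSkew M X ∅ (#E − 2#X)`):
  **`minorPairSkew_contain_disjointSum_of_half`**: (CX*)-cum on every contain-set of `M` and the half rule on every
  contain-set of `N` give (CX*)-cum on every contain-set of `M ⊕ N` (`(n₁ − 2c₁ − 1) + (n₂ − 2c₂) = n − 2c − 1`); hence
  **`biContainSkew_disjointSum_of_half : … → BiContainSkew (M ⊕ N)`** — the split ⊕-closure of (CX*) (the concrete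
  open closure of g28/g29) whenever one summand satisfies the half rule on its contain-sets;
  **`minorPairSkew_half_disjointSum`**: the half rule is closed under ⊕ with split contain-sets;
  **`minorPairSkew_contain_disjointSum_both`**: two (CX*)-cum summands give `MinorPairSkew (M ⊕ N) X ∅ (n − 2c − 2)` —
  the split sum of two (CX*)-matroids loses AT MOST HALF A STEP (census: it loses nothing, g29 §41.15; the residue of the
  split closure is exactly this half step).
* Members of the half-rule class: **`minorPairSkew_half_uniform`** (every uniform matroid, every contain-set — the
  binomial window `C(m, i)` is skewed about `m/2`), **`minorPairSkew_empty_of_biIndepMono`** (`X = ∅` with the monotone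
  form of the profile: `D_i ≤ D_j` for `i < j ≤ #E − i`), hence every direct sum of uniform matroids
  (`minorPairSkew_half_disjointSum`) — so (CX*) holds on every direct sum of uniform matroids with every split
  contain-set (`biContainSkew_disjointSum_uniform`), and g28's one-sided theorem is the case `X ∩ E_N = ∅`.
Nothing here asserts (CX*); every declaration has a docstring; imports: the cell's own modules and Mathlib only.
Axioms: standard. -/

namespace PercRepro

open Set Matroid

variable {α : Type}

/-! ## The cumulative skew of a split-signature direct sum is additive -/

section Sum

variable {M N : Matroid α} [M.Finite] [N.Finite] {h : Disjoint M.E N.E}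

omit [M.Finite] [N.Finite] in
/-- `MinorPairSkew` is the cumulative skew (`SkewConv.Skew`) of the profile sequence. -/
lemma minorPairSkew_iff_skew (M' : Matroid α) (Y₁ Y₂ : Set α) (R : ℕ) :
    MinorPairSkew M' Y₁ Y₂ R ↔ SkewConv.Skew (minorPairCount M' Y₁ Y₂) R := Iff.rfl

/-- **THE CUMULATIVE SKEW IS ADDITIVE UNDER DIRECT SUMS WITH A SPLIT SIGNATURE**: for `A₁, B₁ ⊆ E_M`, `A₂, B₂ ⊆ E_N`
(each pair disjoint), `MinorPairSkew M A₁ B₁ R₁ → MinorPairSkew N A₂ B₂ R₂ →`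
`MinorPairSkew (M ⊕ N) (A₁ ∪ A₂) (B₁ ∪ B₂) (R₁ + R₂)`. -/
theorem minorPairSkew_disjointSum {A₁ B₁ A₂ B₂ : Set α} (hA₁ : A₁ ⊆ M.E) (hB₁ : B₁ ⊆ M.E) (hA₂ : A₂ ⊆ N.E)
    (hB₂ : B₂ ⊆ N.E) (hd₁ : Disjoint A₁ B₁) (hd₂ : Disjoint A₂ B₂) {R₁ R₂ : ℕ}
    (h₁ : MinorPairSkew M A₁ B₁ R₁) (h₂ : MinorPairSkew N A₂ B₂ R₂) :
    MinorPairSkew (M.disjointSum N h) (A₁ ∪ A₂) (B₁ ∪ B₂) (R₁ + R₂) := by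
  rw [minorPairSkew_iff_skew] at h₁ h₂ ⊢
  refine SkewConv.skew_congr (SkewConv.skew_conv h₁ h₂) fun k _ => ?_
  rw [minorPairCount_disjointSum hA₁ hB₁ hA₂ hB₂ hd₁ hd₂ k]
  rfl

/-- The ground set of a direct sum has `#E_M + #E_N` elements. -/
lemma ncard_ground_disjointSum : (M.disjointSum N h).E.ncard = M.E.ncard + N.E.ncard := by
  rw [Matroid.disjointSum_ground_eq, Set.ncard_union_eq h M.ground_finite N.ground_finite]

omit [M.Finite] [N.Finite] in
/-- A subset of the ground set of a direct sum is the union of its traces. -/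
lemma eq_union_inter_of_subset_disjointSum {X : Set α} (hX : X ⊆ (M.disjointSum N h).E) :
    X = X ∩ M.E ∪ X ∩ N.E := by
  rw [Matroid.disjointSum_ground_eq] at hX
  rw [← Set.inter_union_distrib_left, Set.inter_eq_left.mpr hX]

/-- The traces of a subset of the ground set of a direct sum have complementary cardinalities. -/
lemma ncard_inter_add_ncard_inter {X : Set α} (hX : X ⊆ (M.disjointSum N h).E) :
    (X ∩ M.E).ncard + (X ∩ N.E).ncard = X.ncard := by
  have hfin : X.Finite := by
    rw [Matroid.disjointSum_ground_eq] at hX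
    exact (M.ground_finite.union N.ground_finite).subset hX
  rw [← Set.ncard_union_eq (h.mono Set.inter_subset_right Set.inter_subset_right)
    (hfin.subset Set.inter_subset_left) (hfin.subset Set.inter_subset_left),
    ← eq_union_inter_of_subset_disjointSum hX]

/-- **(CX*)-cum ⊕ half rule ⟹ (CX*)-cum, on every contain-set of the sum**: if every contain-set of `M` is skewed
with `R = #E_M − 2#X − 1` and every contain-set of `N` with `R = #E_N − 2#X` (the half rule), then every contain-set
of `M ⊕ N` is skewed with `R = #E − 2#X − 1`. -/
theorem minorPairSkew_contain_disjointSum_of_half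
    (hM : ∀ X ⊆ M.E, MinorPairSkew M X ∅ (M.E.ncard - 2 * X.ncard - 1))
    (hN : ∀ X ⊆ N.E, MinorPairSkew N X ∅ (N.E.ncard - 2 * X.ncard)) :
    ∀ X ⊆ (M.disjointSum N h).E,
      MinorPairSkew (M.disjointSum N h) X ∅ ((M.disjointSum N h).E.ncard - 2 * X.ncard - 1) := by
  intro X hX
  have hsplit := eq_union_inter_of_subset_disjointSum hX
  have hcard := ncard_inter_add_ncard_inter hX
  have hn := ncard_ground_disjointSum (M := M) (N := N) (h := h)
  have key := minorPairSkew_disjointSum (h := h) Set.inter_subset_right (Set.empty_subset _)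
    Set.inter_subset_right (Set.empty_subset _) (Set.disjoint_empty _) (Set.disjoint_empty _)
    (hM (X ∩ M.E) Set.inter_subset_right) (hN (X ∩ N.E) Set.inter_subset_right)
  rw [Set.union_empty, ← hsplit] at key
  refine minorPairSkew_mono _ key ?_
  omega

/-- **THE SPLIT ⊕-CLOSURE OF (CX*) WITH A HALF-RULE SUMMAND**: `BiContainSkew (M ⊕ N)`. -/
theorem biContainSkew_disjointSum_of_half
    (hM : ∀ X ⊆ M.E, MinorPairSkew M X ∅ (M.E.ncard - 2 * X.ncard - 1))
    (hN : ∀ X ⊆ N.E, MinorPairSkew N X ∅ (N.E.ncard - 2 * X.ncard)) :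
    haveI : (M.disjointSum N h).Finite := ⟨by
      rw [Matroid.disjointSum_ground_eq]; exact M.ground_finite.union N.ground_finite⟩
    BiContainSkew (M.disjointSum N h) :=
  haveI : (M.disjointSum N h).Finite := ⟨by
    rw [Matroid.disjointSum_ground_eq]; exact M.ground_finite.union N.ground_finite⟩
  biContainSkew_of_minorPairSkew _ (minorPairSkew_contain_disjointSum_of_half hM hN)

/-- **The half rule is closed under ⊕ with split contain-sets.** -/
theorem minorPairSkew_half_disjointSum
    (hM : ∀ X ⊆ M.E, MinorPairSkew M X ∅ (M.E.ncard - 2 * X.ncard))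
    (hN : ∀ X ⊆ N.E, MinorPairSkew N X ∅ (N.E.ncard - 2 * X.ncard)) :
    ∀ X ⊆ (M.disjointSum N h).E,
      MinorPairSkew (M.disjointSum N h) X ∅ ((M.disjointSum N h).E.ncard - 2 * X.ncard) := by
  intro X hX
  have hsplit := eq_union_inter_of_subset_disjointSum hX
  have hcard := ncard_inter_add_ncard_inter hX
  have hn := ncard_ground_disjointSum (M := M) (N := N) (h := h)
  have key := minorPairSkew_disjointSum (h := h) Set.inter_subset_right (Set.empty_subset _)
    Set.inter_subset_right (Set.empty_subset _) (Set.disjoint_empty _) (Set.disjoint_empty _)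
    (hM (X ∩ M.E) Set.inter_subset_right) (hN (X ∩ N.E) Set.inter_subset_right)
  rw [Set.union_empty, ← hsplit] at key
  refine minorPairSkew_mono _ key ?_
  omega

/-- **THE HALF-STEP BOUND**: two (CX*)-cum summands give the cumulative skew of the split contain-sets of the sum with
`R = #E − 2#X − 2` — half a step short of (CX*). -/
theorem minorPairSkew_contain_disjointSum_both
    (hM : ∀ X ⊆ M.E, MinorPairSkew M X ∅ (M.E.ncard - 2 * X.ncard - 1))
    (hN : ∀ X ⊆ N.E, MinorPairSkew N X ∅ (N.E.ncard - 2 * X.ncard - 1)) :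
    ∀ X ⊆ (M.disjointSum N h).E,
      MinorPairSkew (M.disjointSum N h) X ∅ ((M.disjointSum N h).E.ncard - 2 * X.ncard - 2) := by
  intro X hX
  have hsplit := eq_union_inter_of_subset_disjointSum hX
  have hcard := ncard_inter_add_ncard_inter hX
  have hn := ncard_ground_disjointSum (M := M) (N := N) (h := h)
  have key := minorPairSkew_disjointSum (h := h) Set.inter_subset_right (Set.empty_subset _)
    Set.inter_subset_right (Set.empty_subset _) (Set.disjoint_empty _) (Set.disjoint_empty _)
    (hM (X ∩ M.E) Set.inter_subset_right) (hN (X ∩ N.E) Set.inter_subset_right)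
  rw [Set.union_empty, ← hsplit] at key
  refine minorPairSkew_mono _ key ?_
  omega

end Sum

/-! ## Members of the half-rule class -/

/-- The monotone form gives `D_i ≤ D_j` for `i ≤ j ≤ #E/2`. -/
lemma biIndepCount_le_of_le_of_biIndepMono (M : Matroid α) [M.Finite] (hM : BiIndepMono M) {i j : ℕ}
    (hij : i ≤ j) (hj : 2 * j ≤ M.E.ncard) : biIndepCount M i ≤ biIndepCount M j := by
  induction j with
  | zero =>
    have : i = 0 := by omega
    rw [this]
  | succ j ih =>
    rcases Nat.eq_or_lt_of_le hij with rfl | hlt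
    · exact le_rfl
    · exact (ih (by omega) (by omega)).trans (biIndepCount_le_succ_of_biIndepMono M hM (by omega))

/-- **`X = ∅` WITH THE MONOTONE PROFILE SATISFIES THE HALF RULE**: `BiIndepMono M → MinorPairSkew M ∅ ∅ #E`
(`D_i ≤ D_j` for `i < j ≤ #E − i`, by the monotonicity up to the middle and the symmetry `D_j = D_{#E−j}`). -/
theorem minorPairSkew_empty_of_biIndepMono (M : Matroid α) [M.Finite] (hM : BiIndepMono M) :
    MinorPairSkew M ∅ ∅ M.E.ncard := by
  intro i j hij hR
  have hD : ∀ k, minorPairCount M ∅ ∅ k = biIndepCount M k := by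
    intro k
    have := biContainCount_eq_minorPairCount M (Set.empty_subset M.E) (k := k) (by simp)
    rw [Set.ncard_empty, Nat.sub_zero] at this
    rw [← this, biContainCount_empty]
  rw [hD, hD]
  by_cases hj : 2 * j ≤ M.E.ncard
  · exact biIndepCount_le_of_le_of_biIndepMono M hM hij.le hj
  · rw [← biIndepCount_compl M j (by omega)]
    exact biIndepCount_le_of_le_of_biIndepMono M hM (by omega) (by omega)

/-- **EVERY UNIFORM MATROID SATISFIES THE HALF RULE ON EVERY CONTAIN-SET**: for `U_{p,E} = modelMatroid hE ∅ q p` and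
`X ⊆ E`, `MinorPairSkew U X ∅ (#E − 2#X)` — the profile is the binomial window `C(#E − #X, i)` on
`[#E − p − #X, p − #X]`, skewed about `(#E − #X)/2`. -/
theorem minorPairSkew_half_uniform {E : Set α} (hE : E.Finite) (q p : ℕ) {X : Set α} (hX : X ⊆ E) :
    haveI := modelMatroid_finite hE ∅ q p
    MinorPairSkew (modelMatroid hE ∅ q p) X ∅ (E.ncard - 2 * X.ncard) := by
  haveI := modelMatroid_finite hE ∅ q p
  intro i j hij hR
  have hXfin : X.Finite := hE.subset hX
  have hm : (E \ (X ∪ ∅)).ncard = E.ncard - X.ncard := by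
    rw [Set.union_empty, Set.ncard_sdiff hX hXfin]
  have hXE : X.ncard ≤ E.ncard := Set.ncard_le_ncard hX hE
  rw [minorPairCount_uniform hE q p hX (Set.empty_subset _) i, minorPairCount_uniform hE q p hX (Set.empty_subset _) j,
    hm, Set.ncard_empty, add_zero, add_zero]
  split_ifs with hi hj hj
  · exact choose_le_choose_of_le_of_le_sub hij.le (by omega)
  · exfalso
    omega
  · exact Nat.zero_le _
  · exact le_rfl

/-- **(CX*) ON EVERY DIRECT SUM OF TWO UNIFORM MATROIDS WITH EVERY SPLIT CONTAIN-SET** (the half rule of both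
summands adds to the half rule of the sum, which is stronger than (CX*)). -/
theorem biContainSkew_disjointSum_uniform {E₁ E₂ : Set α} (hE₁ : E₁.Finite) (hE₂ : E₂.Finite) (q₁ p₁ q₂ p₂ : ℕ)
    (h : Disjoint (modelMatroid hE₁ ∅ q₁ p₁).E (modelMatroid hE₂ ∅ q₂ p₂).E) :
    haveI := modelMatroid_finite hE₁ ∅ q₁ p₁
    haveI := modelMatroid_finite hE₂ ∅ q₂ p₂
    haveI : ((modelMatroid hE₁ ∅ q₁ p₁).disjointSum (modelMatroid hE₂ ∅ q₂ p₂) h).Finite := ⟨by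
      rw [Matroid.disjointSum_ground_eq]; exact hE₁.union hE₂⟩
    BiContainSkew ((modelMatroid hE₁ ∅ q₁ p₁).disjointSum (modelMatroid hE₂ ∅ q₂ p₂) h) := by
  haveI := modelMatroid_finite hE₁ ∅ q₁ p₁
  haveI := modelMatroid_finite hE₂ ∅ q₂ p₂
  haveI : ((modelMatroid hE₁ ∅ q₁ p₁).disjointSum (modelMatroid hE₂ ∅ q₂ p₂) h).Finite := ⟨by
    rw [Matroid.disjointSum_ground_eq]; exact hE₁.union hE₂⟩
  refine biContainSkew_of_minorPairSkew _ fun X hX => ?_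
  refine minorPairSkew_mono _ (minorPairSkew_half_disjointSum (h := h) (fun Y hY => ?_) (fun Y hY => ?_) X hX)
    (Nat.sub_le _ _)
  · exact minorPairSkew_half_uniform hE₁ q₁ p₁ hY
  · exact minorPairSkew_half_uniform hE₂ q₂ p₂ hY

end PercRepro
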